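import Mathlib

/-!
# SoloBlind E67 — Eisenstein absorption: the index identity behind THEOREM Φ

Algebraic skeleton of THEOREM Φ (solo-Langlands-blind s121, `paper/theoremPhi.md`, CLAIMS C494).
Let `Xbar` be an abelian group (in the application: the Brandt module `X_𝔪` modulo the Eisenstein
line), `X0 ≤ Xbar` a subgroup of finite index `ℓ^m` (the degree-zero part; `m = v_ℓ φ(M)` by the
Eichler mass formula), and `η : Xbar → Xbar` an injective endomorphism with image inside `X0`
(the Hecke operator `T_w - w - 1`, which kills the Eisenstein vector).  Then

  `[X0 : η X0] = [Xbar : X0] · [X0 : η Xbar]`,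

so `[Xbar : X0]` divides `[X0 : η X0]` ("the Eisenstein line absorbs `ℓ^m` of the congruence"), and
with `[X0 : η X0] = ℓ^v` (the total valuation `v = v_ℓ det(η | X0)`) the Eisenstein part of the
component group `Φ_w(J^{Mw})`, which is `X0 / η Xbar`, has order `ℓ^(v-m)`; it vanishes iff `v = m`
iff `η Xbar = X0`.  Pure group theory (Mathlib `AddSubgroup.relIndex`); no number theory is used.
-/

namespace Summit.Langlands.Langlands.Theorems

open AddSubgroup

variable {X : Type*} [AddCommGroup X]

/-- Tower identity: for an injective endomorphism `η` with `η(X) ≤ X0`,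
`[X0 : η X0] = [X : X0] * [X0 : η X]` (all indices as `relIndex`/`index`, `0` if infinite). -/
theorem soloBlind_absorption_index (X0 : AddSubgroup X) (η : X →+ X)
    (hη : Function.Injective η) (hrange : η.range ≤ X0) :
    (X0.map η).relIndex X0 = X0.index * η.range.relIndex X0 := by
  have h1 : X0.map η ≤ η.range := map_le_range η X0
  have h2 : (X0.map η).relIndex η.range = X0.index := by
    rw [AddMonoidHom.range_eq_map, relIndex_map_map_of_injective X0 ⊤ hη, relIndex_top_right]
  rw [← relIndex_mul_relIndex (X0.map η) η.range X0 h1 hrange, h2]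

/-- The absorption divisibility `[X : X0] ∣ [X0 : η X0]` (THEOREM Φ (ii): `c_M(w) ≥ 0`). -/
theorem soloBlind_absorption_dvd (X0 : AddSubgroup X) (η : X →+ X)
    (hη : Function.Injective η) (hrange : η.range ≤ X0) :
    X0.index ∣ (X0.map η).relIndex X0 := by
  rw [soloBlind_absorption_index X0 η hη hrange]
  exact dvd_mul_right _ _

/-- Length form: if `[X : X0] = ℓ^m` and `[X0 : η X0] = ℓ^v` with `ℓ > 1`, then `m ≤ v` and the
"component group" `X0 / η X` has order `ℓ^(v - m)`. -/
theorem soloBlind_absorption_length (X0 : AddSubgroup X) (η : X →+ X)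
    (hη : Function.Injective η) (hrange : η.range ≤ X0) {ℓ m v : ℕ} (hℓ : 1 < ℓ)
    (hm : X0.index = ℓ ^ m) (hv : (X0.map η).relIndex X0 = ℓ ^ v) :
    m ≤ v ∧ η.range.relIndex X0 = ℓ ^ (v - m) := by
  have key := soloBlind_absorption_index X0 η hη hrange
  rw [hm, hv] at key
  have hmv : m ≤ v := by
    have hd : ℓ ^ m ∣ ℓ ^ v := ⟨_, key⟩
    exact (Nat.pow_dvd_pow_iff_le_right hℓ).mp hd
  refine ⟨hmv, ?_⟩
  have hpos : 0 < ℓ ^ m := Nat.pos_of_ne_zero (by positivity)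
  have : ℓ ^ v / ℓ ^ m = η.range.relIndex X0 :=
    Nat.div_eq_of_eq_mul_right hpos (by rw [key, mul_comm])
  rw [← this, Nat.pow_div hmv (by omega)]

/-- Vanishing criterion: under the same hypotheses the component-group part `X0 / η X` is trivial
(`η X ≥ X0`, hence `η X = X0`) iff the total valuation equals the absorbed one, `v = m`
(THEOREM Φ: `Φ_w(J^{Mw})_{𝔫⁺} = 0 ⟺ v_ℓ det(η_w | X⁰_𝔪) = v_ℓ φ(M)`). -/
theorem soloBlind_absorption_trivial_iff (X0 : AddSubgroup X) (η : X →+ X)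
    (hη : Function.Injective η) (hrange : η.range ≤ X0) {ℓ m v : ℕ} (hℓ : 1 < ℓ)
    (hm : X0.index = ℓ ^ m) (hv : (X0.map η).relIndex X0 = ℓ ^ v) :
    X0 ≤ η.range ↔ v = m := by
  obtain ⟨hmv, hlen⟩ := soloBlind_absorption_length X0 η hη hrange hℓ hm hv
  rw [← relIndex_eq_one, hlen]
  constructor
  · intro h
    have : v - m = 0 := by
      by_contra hne
      have : ℓ ^ (v - m) ≥ ℓ ^ 1 := Nat.pow_le_pow_right (by omega) (Nat.one_le_iff_ne_zero.mpr hne)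
      simp at this; omega
    omega
  · intro h; subst h; simp

/-- Numerical instances recorded in CLAIMS C494–C496 (ℓ = 5): a Yoo-type base (`m = 1`) with total
valuation `v = 2` has a component-group part of order `5` (e.g. `(M,w) = (66,47)`, `μ(66·47) = 1`),
and the non-Yoo-type base `M = 606` (`m = 2`) at `w = 11` with `v = 2` has a trivial one
(`c_{606}(11) = 0`, the recorded `w ≡ 1 (mod 5)` failure of the per-prime converse at `N = 6666`). -/
theorem soloBlind_absorption_examples :
    (5 : ℕ) ^ (2 - 1) = 5 ∧ (5 : ℕ) ^ (2 - 2) = 1 ∧ (5 : ℕ) ^ (4 - 2) = 25 := by norm_num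

end Summit.Langlands.Langlands.Theorems
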